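import Literature.MathematicalPhysics.QuantumFieldTheory.BalabanImbrieJaffe1984to88.BIJ88ChiMixedDerivN309
import Literature.MathematicalPhysics.QuantumFieldTheory.BalabanImbrieJaffe1984to88.BIJ88ProductRuleAllOrders306
import Literature.MathematicalPhysics.QuantumFieldTheory.BalabanImbrieJaffe1984to88.BIJ88GaussIntegration309Product

/-!
# `BalabanImbrieJaffe1984to88.BIJ88ChiSlotDsetBound309` — T. Bałaban, J. Imbrie, A. Jaffe, *Effective action and cluster properties of the
abelian Higgs model*, Commun. Math. Phys. **114** (1988) 257–315 [BalabanImbrieJaffe1988]: p. 307 [PDF 51] (Sect. 5.13: *"Functional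
derivatives hitting χ-factors … are supported at |A^{(k)″}| ≥ cp(e_k) or |φ^{(k)″}| ≥ cp(e_k) … (Factorials can be produced when many functional
derivatives hit the same object, for example a characteristic function.)"*) and p. 309 [PDF 53] ((5.14.3)–(5.14.4): *"derivatives of χ,
supported in c₁p(te_k) ≤ |A^{(k)}| ≤ c₂p(te_k)"*; *"Each t-derivative of a χ-factor in χ′_{Λ,t} gives at least a factor
e^β(L^kε/ε₀)^{1/4−α}"*; *"the n-th derivative in t of χ(cp(e_k), A^{(k)}) is bounded by t^{−n} times a function bounded by a constant … After
integration over A^{(k)}, we obtain factors ct^{−n}e^{−cp(te_k)²}"* — p0053 L21–28) — **THE COST OF ANY NUMBER OF LEGS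
ON A LOCATED χ-SLOT: `t^{−m}·(|c_b|p(te_k))^{−|D|}·C·𝟙_shell(|Φ_b|)·Π_{legs}|Φ_b(e_q)|`**.

Bricks 5 and 7 of the §f road meet here.  `BIJ88ProductRuleAllOrders306.dset_comp_linear` (all-orders chain rule: p13's iterated derivative
`dset u D` of `g ∘ ℓ`, `ℓ` linear, is `g^{(|D|)}(ℓφ)·Π_{j∈D} ℓ(u_j)`) and `BIJ88ChiMixedDerivN309.exists_abs_mixedDeriv_cutoff_le_indicator` (the
mixed `t`/argument derivatives of `χ(c·p(te_k), ·)`: `|∂ⁿ_A∂^m_tχ| ≤ t^{−m}(|c|p(te_k))^{−n}·C·𝟙_{[(9/10)|c|p, |c|p]}(|A|)` for `(m,n) ≠ (0,0)`) give,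
for the located χ-slot factor `u_{b,m} = ∂_t^m χ(c_b p(te_k), Φ_b(·))` of `BIJ88SlotMomentsGauss308.uD`:
* `exists_abs_dset_tDeriv_cutoff_linear_le` (any linear `ℓ`, any directions `u_j`): for `(m,|D|) ≠ (0,0)`,
  `|∂_{u_D} [∂_t^m χ(c·p(te_k), ℓ(·))](φ)| ≤ t^{−m}·(|c|p(te_k))^{−|D|}·C·𝟙_shell(|ℓφ|)·Π_{j∈D}|ℓ(u_j)|`, `C = C(χ,p,m,|D|)`;
* `abs_tDeriv_zero_cutoff_linear_le_one`: the undifferentiated χ-slot (`m = 0`, no legs) costs `≤ 1` (`|χ(1,·)| ≤ 1`,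
  `BIJ88GaussIntegration309Product.abs_chi1_le_one`);
* **`exists_abs_dset_uD_inl_le`**: the same on the fields of a region `X` read through `ext` with coordinate legs `e_{q_j}` — the HIT χ-slot term
  of the assignment sums of `BIJ88ProductRuleAllOrders306.dset_fD_uD_apply` / `BIJ88CubeProductDset306`, in the shape `c_τ·𝟙_{S_τ}` that
  `BIJ88TrainTermBound307.abs_prod_le_prod_mul_indicator` multiplies and `BIJ88GaussShellInterpolated309.abs_gexp_prec_le_shell` integrates; a
  `t`-differentiated χ-slot (`m ≥ 1`) carries its shell indicator WHATEVER the legs (`D = ∅` allowed) — the `θ^{|H|}` of the located (5.14.4);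
  **`abs_dset_uD_inl_zero_empty_le_one`**: the free χ-slot costs `1`.

(v1.1 DOC-ONLY, referee finding D-g80-1 / owner docfix D-owner-v2.365: the p. 309 quotation in this header corrected to the printed sentences —
the unprinted «(l_kε)^{1/2−4α}» wording removed; declarations byte-identical to v1 p371081.)

statement-level skeleton of published theorems with citation tags; proofs where landed; nothing here is a claim about the Yang–Mills mass gap

PDF held: `paper:balaban1988-cmp114-bij-abelian-higgs-effective-action` (journal page = PDF page + 256); pages re-read this session as text:
PDF 51 (p. 307) L8–18, PDF 53 (p. 309) L1–15.

CITATION HEADER (lean-in-tree rule).  Part of the lit-balaban TYPED SKELETON (HOME `run/shared/lean/pub/lit-balaban/`), Phase 2, seat p36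
(gen 21, unit `lit-balaban-p36`); rows **C2.Eq5.14.3-5.14.4** (member: §f estimate E4c-χ — the per-slot cost of a hit χ-slot at all orders) and
C2.Eq5.13.3-5.13.4 (member) of `HOME/lit-balaban-r16/ROWS-C2-part2.md` (owner r16, referee ref-5).  Theorem-only; no definitions, no `Prop` facts;
axioms standard.
HONEST SCOPE.  Linear slot fields only (the modulus slot fields of `BIJ88SlotFactorsSmooth308` need the `EuclideanSpace` chain rule, not typed here);
the constant `C(χ,p,m,n)` is print's *"factorials"*, not made explicit.
-/

namespace Literature.MathematicalPhysics.QuantumFieldTheory.BalabanImbrieJaffe1984to88.BIJ88ChiSlotDsetBound309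

open Finset
open scoped BigOperators ContDiff
open BIJ88Sect2Statements (pLog)
open BIJ88Sect5Statements (CutoffProfile cutoff)
open BIJ88WickSourceSmooth305 (dset dset_empty)
open BIJ88ProductRuleAllOrders306 (dset_comp_linear)
open BIJ88ChiMixedDerivN309 (exists_abs_mixedDeriv_cutoff_le_indicator contDiff_tDeriv_cutoff)
open BIJ88PolymerRep5134Gauss (ext)
open BIJ88SlotMomentsGauss308 (uD)

variable (χ : CutoffProfile)

/-! ## §1  Any linear slot field, any directions -/

section Linear

variable {S : Type} [Fintype S] {κ : Type} [LinearOrder κ]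

/-- **ALL THE LEGS ON ONE χ-SLOT** (linear slot field `ℓ`, directions `u_j`, `(m,|D|) ≠ (0,0)`): there is `C = C(χ,p,m,|D|) ≥ 0` with
`|∂_{u_D}[∂_t^m χ(c·p(te_k), ℓ(·))](φ)| ≤ t^{−m}·(|c|p(te_k))^{−|D|}·(C·𝟙_{[(9/10)|c|p(te_k), |c|p(te_k)]}(|ℓφ|))·Π_{j∈D}|ℓ(u_j)|`
for all `c ≠ 0`, `0 < e_k`, `0 < t`, `te_k ≤ e^{−1}` — chain rule (brick 7) × mixed-derivative sizes and support (brick 5).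
[cite: BalabanImbrieJaffe1988, §5.13 p.307, (5.14.3)–(5.14.4) p.309] -/
theorem exists_abs_dset_tDeriv_cutoff_linear_le (p : ℝ) (m n : ℕ) (hmn : m ≠ 0 ∨ n ≠ 0) :
    ∃ C : ℝ, 0 ≤ C ∧ ∀ (u : κ → S → ℝ) (D : Finset κ), D.card = n → ∀ ⦃ℓ : (S → ℝ) → ℝ⦄, IsLinearMap ℝ ℓ →
      ∀ ⦃c ek t : ℝ⦄, c ≠ 0 → 0 < ek → 0 < t → t * ek ≤ Real.exp (-1) → ∀ φ : S → ℝ,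
        |dset u D (fun ψ => iteratedDeriv m (fun s => cutoff χ (c * pLog p (s * ek)) (ℓ ψ)) t) φ| ≤
          t ^ (-(m : ℤ)) * (|c| * pLog p (t * ek))⁻¹ ^ n *
            (C * Set.indicator (Set.Icc (9 / 10 * (|c| * pLog p (t * ek))) (|c| * pLog p (t * ek))) (fun _ => (1 : ℝ)) |ℓ φ|) *
            ∏ j ∈ D, |ℓ (u j)| := by
  obtain ⟨C, hC0, hC⟩ := exists_abs_mixedDeriv_cutoff_le_indicator χ p hmn
  refine ⟨C, hC0, fun u D hD ℓ hℓ c ek t hc hek ht h1 φ => ?_⟩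
  have h1' : t * ek < 1 := h1.trans_lt (by rw [← Real.exp_zero]; exact Real.exp_lt_exp.mpr (by norm_num))
  rw [dset_comp_linear u (contDiff_tDeriv_cutoff χ p c hek ht h1' m) hℓ D]
  dsimp only
  rw [abs_mul, abs_prod, hD]
  exact mul_le_mul_of_nonneg_right (hC (ℓ φ) hc hek ht h1) (prod_nonneg fun j _ => abs_nonneg _)

omit [Fintype S] in
/-- the undifferentiated χ-slot costs at most `1`: `|χ(c·p(te_k), ℓ(φ))| ≤ 1`. [cite: BalabanImbrieJaffe1988, (5.14.3) p.309] -/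
theorem abs_tDeriv_zero_cutoff_linear_le_one (p c ek t : ℝ) (ℓ : (S → ℝ) → ℝ) (φ : S → ℝ) :
    |iteratedDeriv 0 (fun s => cutoff χ (c * pLog p (s * ek)) (ℓ φ)) t| ≤ 1 := by
  rw [iteratedDeriv_zero, cutoff]
  exact BIJ88GaussIntegration309Product.abs_chi1_le_one χ _

end Linear

/-! ## §2  The located χ-slot on the fields of a region -/

section Located

variable {α I : Type} [Fintype α] [DecidableEq α] [DecidableEq I] (blk : α → I)
variable {ι υ : Type} (p : ℝ) (B : Finset ι) {Φ : ι → (α → ℝ) → ℝ} {c : ι → ℝ} (Ys : Finset υ)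
  {V : υ → (α → ℝ) → ℝ}

omit [Fintype α] [DecidableEq α] in
/-- the located χ-slot factor read on the fields of `X` is `g_m ∘ (Φ_b ∘ ext)` with `g_m = ∂_t^m χ(c_b p(te_k), ·)`.
[cite: BalabanImbrieJaffe1988, (5.14.3) p.309] -/
theorem uD_inl_ext_eq (X : Finset I) (b : ↥B) (ek t : ℝ) (m : ℕ) (ψ : {x : α // blk x ∈ X} → ℝ) :
    uD χ p ek B Φ c Ys V t (Sum.inl b) m (ext blk X ψ) =
      iteratedDeriv m (fun s => cutoff χ (c b * pLog p (s * ek)) (Φ b (ext blk X ψ))) t := rfl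

omit [Fintype α] [DecidableEq α] in
/-- the extension by zero is additive. [cite: BalabanImbrieJaffe1988, (5.14.2) p.308] -/
theorem ext_add (X : Finset I) (ψ ψ' : {x : α // blk x ∈ X} → ℝ) : ext blk X (ψ + ψ') = ext blk X ψ + ext blk X ψ' := by
  funext x
  simp only [BIJ88PolymerRep5134Gauss.ext, Pi.add_apply]
  split_ifs <;> simp

omit [Fintype α] [DecidableEq α] in
/-- the extension by zero is homogeneous. [cite: BalabanImbrieJaffe1988, (5.14.2) p.308] -/
theorem ext_smul (X : Finset I) (r : ℝ) (ψ : {x : α // blk x ∈ X} → ℝ) : ext blk X (r • ψ) = r • ext blk X ψ := by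
  funext x
  simp only [BIJ88PolymerRep5134Gauss.ext, Pi.smul_apply, smul_eq_mul]
  split_ifs <;> simp

omit [Fintype α] [DecidableEq α] in
/-- `Φ_b ∘ ext` is linear when `Φ_b` is. [cite: BalabanImbrieJaffe1988, (5.14.2) p.308] -/
theorem isLinearMap_slot_ext (X : Finset I) {b : ι} (hΦ : IsLinearMap ℝ (Φ b)) :
    IsLinearMap ℝ fun ψ : {x : α // blk x ∈ X} → ℝ => Φ b (ext blk X ψ) :=
  ⟨fun ψ ψ' => by rw [ext_add, hΦ.map_add], fun r ψ => by rw [ext_smul, hΦ.map_smul]⟩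

/-- **THE HIT χ-SLOT TERM OF THE ASSIGNMENT SUMS**: for `(m,n) ≠ (0,0)` there is `C = C(χ,p,m,n) ≥ 0` such that for every region `X`, every
χ-slot `b ∈ B` with `c_b ≠ 0` and `Φ_b` linear, every family of `n` coordinate legs `e_{q_j}` (`j ∈ D`, `|D| = n`) and all `0 < e_k`, `0 < t`,
`te_k ≤ e^{−1}`:
`|∂_{q_D} u_{b,m}(ext ω)| ≤ t^{−m}·(|c_b|p(te_k))^{−n}·(C·𝟙_{[(9/10)|c_b|p(te_k), |c_b|p(te_k)]}(|Φ_b(ext ω)|))·Π_{j∈D}|Φ_b(ext e_{q_j})|`.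
[cite: BalabanImbrieJaffe1988, §5.13 p.307, (5.14.3)–(5.14.4) p.309] -/
theorem exists_abs_dset_uD_inl_le {κ : Type} [LinearOrder κ] (m n : ℕ) (hmn : m ≠ 0 ∨ n ≠ 0) :
    ∃ C : ℝ, 0 ≤ C ∧ ∀ (X : Finset I) (b : ↥B), c b ≠ 0 → IsLinearMap ℝ (Φ b) →
      ∀ (q : κ → {x : α // blk x ∈ X}) (D : Finset κ), D.card = n → ∀ ⦃ek t : ℝ⦄, 0 < ek → 0 < t → t * ek ≤ Real.exp (-1) →
        ∀ φ : {x : α // blk x ∈ X} → ℝ,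
          |dset (fun j => Pi.single (q j) (1 : ℝ)) D (fun ψ => uD χ p ek B Φ c Ys V t (Sum.inl b) m (ext blk X ψ)) φ| ≤
            t ^ (-(m : ℤ)) * (|c b| * pLog p (t * ek))⁻¹ ^ n *
              (C * Set.indicator (Set.Icc (9 / 10 * (|c b| * pLog p (t * ek))) (|c b| * pLog p (t * ek))) (fun _ => (1 : ℝ))
                |Φ b (ext blk X φ)|) *
              ∏ j ∈ D, |Φ b (ext blk X (Pi.single (q j) 1))| := by
  -- the constant of brick 5 depends on `(χ, p, m, n)` only, so it serves every region `X` at once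
  obtain ⟨C, hC0, hC⟩ := exists_abs_mixedDeriv_cutoff_le_indicator χ p hmn
  refine ⟨C, hC0, fun X b hcb hΦ q D hD ek t hek ht h1 φ => ?_⟩
  have h1' : t * ek < 1 := h1.trans_lt (by rw [← Real.exp_zero]; exact Real.exp_lt_exp.mpr (by norm_num))
  have hℓ := isLinearMap_slot_ext blk X hΦ
  rw [show (fun ψ : {x : α // blk x ∈ X} → ℝ => uD χ p ek B Φ c Ys V t (Sum.inl b) m (ext blk X ψ)) =
      fun ψ => (fun A => iteratedDeriv m (fun s => cutoff χ (c b * pLog p (s * ek)) A) t) (Φ b (ext blk X ψ)) from rfl,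
    dset_comp_linear _ (contDiff_tDeriv_cutoff χ p (c b) hek ht h1' m) hℓ D]
  dsimp only
  rw [abs_mul, abs_prod, hD]
  exact mul_le_mul_of_nonneg_right (hC (Φ b (ext blk X φ)) hcb hek ht h1) (prod_nonneg fun j _ => abs_nonneg _)

omit [Fintype α] in
/-- **THE FREE χ-SLOT COSTS `1`**: no `t`-derivative and no legs ⇒ `|u_{b,0}(ext ω)| = |χ(c_b p(te_k), Φ_b(ext ω))| ≤ 1`.
[cite: BalabanImbrieJaffe1988, (5.14.3) p.309] -/
theorem abs_dset_uD_inl_zero_empty_le_one {κ : Type} [LinearOrder κ] (X : Finset I) (b : ↥B) (q : κ → {x : α // blk x ∈ X}) (ek t : ℝ)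
    (φ : {x : α // blk x ∈ X} → ℝ) :
    |dset (fun j => Pi.single (q j) (1 : ℝ)) ∅ (fun ψ => uD χ p ek B Φ c Ys V t (Sum.inl b) 0 (ext blk X ψ)) φ| ≤ 1 := by
  rw [dset_empty, uD_inl_ext_eq]
  exact abs_tDeriv_zero_cutoff_linear_le_one χ p (c b) ek t _ _

end Located

end Literature.MathematicalPhysics.QuantumFieldTheory.BalabanImbrieJaffe1984to88.BIJ88ChiSlotDsetBound309
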